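import Literature.MathematicalPhysics.QuantumFieldTheory.Balaban1983to89.B9Eq34CovCurlVector

/-!
# `Balaban1983to89.B9Eq311L2Pairing` — T. Bałaban, *Propagators for lattice gauge theories in a background field*, Commun. Math.
# Phys. **99** (1985) 389–434 [Balaban1985BackgroundPropagators], p. 391 *«The adjoints are taken with respect to natural L² scalar products
# for functions with values in N × N hermitian matrices»* and (3.11) `⟨A, J⟩ = Σ_{b⊂T_η} η^d tr A(b)J(b)`: the WEIGHTED `L²` SCALAR PRODUCTS of the
# series AS GENUINE INNER-PRODUCT SPACES (Mathlib `InnerProductSpace` instances on function carriers), the cell's «adjoint pair»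
# hypothesis shape AS `LinearMap.adjoint`, and the lattice instances: (3.8) `D* = D†`, (3.9) `= (3.4)†`, `D*D = D†D` symmetric and positive

statement-level skeleton of published theorems with citation tags; proofs where landed; nothing here is a claim
about the Yang–Mills mass gap

PDF held: `paper:balaban1985-cmp99-background-propagators` (journal page = PDF page + 388); pp. 391–392 (PDF 3–4) read from the held text by
this seat (`lit read`, 2026-08-21).

THE PRINT (verbatim, pp. 391–392).  *«In the sequel we will frequently use adjoint operators to derivatives D. The adjoints are taken with
respect to natural L² scalar products for functions with values in N × N hermitian matrices. The inner product for these matrices is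
defined by X·Y = tr XY. Let us recall that the trace is normalized, i.e., tr 1 = 1. For example, for derivative D acting on functions
defined at points of the lattice, the adjoint operator D* is acting on functions A defined at bonds of the lattice by the formulas (3.8) …
The operator adjoint to derivative D, acting on functions defined at bonds, is the operator acting on functions F defined at plaquetts by the
formula (3.9) … it is a hermitian operator given by the quadratic form ⟨A, ΔA⟩ = Σ_p η^d |(DA)(p)|² + … (3.10) … Let us write the linear
term in (3.7) as ⟨A, J⟩ = Σ_{b⊂T_η} η^d tr A(b)J(b), (3.11)»*; [B11] = [Balaban1985Variational] p. 293: *«𝔓 is an orthogonal projection in a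
space of configurations A′ with a scalar product defined by the operator Δ₁ + D*RD + aQ*Q»*.

WHY THIS FILE (cell context).  Every B9 file of the tree that speaks of adjoints carries them as a HYPOTHESIS SHAPE `hadj : ∀ x φ, ⟨q x, φ⟩ =
⟨x, qs φ⟩` over abstract inner-product spaces (`B9Thm311Data`, `B9Eq323Ker`, `B9Eq319Onto` — whose header records the common gap verbatim:
*«NOT HERE: the realisation of L²(Ω₀, 𝔤), L²(𝔅) as Mathlib inner-product spaces … pi types X → V with weighted products have no
InnerProductSpace instance; recorded, not bridged»*), and the companion files `B9Eq33CovDerivVector` / `B9Eq34CovCurlVector` (NE9 owner, letters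
(L1′)/(L1″)) prove the adjointness of (3.8)/(3.9) as identities between weighted sums.  THIS FILE bridges the gap: the weighted `L²` pairing as a
genuine `InnerProductSpace` on a type synonym (§1), the sum-form adjoint pair ⟹ `LinearMap.adjoint` (§2), and the lattice operators of (3.3),
(3.4), (3.8), (3.9), `D*D` between these spaces with `D* = D†`, `(3.9) = (3.4)†`, `D*D = D†D` symmetric positive (§3–§4) — the Hilbert-space
setting in which [B11]'s `𝔓` («orthogonal projection in the scalar product defined by Δ₁ + D*RD + aQ*Q») and `G₁` will be objects (letters
(L2)/(L4)/(L6) of the pub-balaban NE9 letter map).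

WHAT IS DEFINED AND PROVED (sorry-free; no `Prop` placeholder; no inequality of the paper).
* §1 `WL2 𝕜 w V` — the type synonym of `X → V` (`X` finite, `V` an inner-product space over `𝕜 = ℝ` or `ℂ` (`RCLike`), weight `w > 0` by `Fact`)
  with `⟪f, g⟫ = Σ_x w(x)⟪f(x), g(x)⟫` as an `InnerProductSpace.Core` ⟹ instances `NormedAddCommGroup`, `InnerProductSpace 𝕜`, `FiniteDimensional`,
  `CompleteSpace`; `inner_def`, `norm_sq` (`‖f‖² = Σ_x w(x)‖f(x)‖²`), `weight_mul_norm_sq_apply_le`.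
* §2 **`adjoint_eq_of_sum_inner`**: `(∀ f g, Σ_y w′(y)⟨(Tf)(y), g(y)⟩ = Σ_x w(x)⟨f(x), (Sg)(x)⟩) → LinearMap.adjoint T = S`.
* §3 `SiteL2` / `BondL2` (uniform weight `c₀ = η^d`), `covDerivL2` / `covDivL2` = (3.3)/(3.8) between them, **`adjoint_covDerivL2`**:
  `LinearMap.adjoint (covDerivL2 c₀ c R) = covDivL2 c₀ c S` for mutually adjoint transporter data (print's unitary `R(U(b))`) — (3.8) IS `D†`;
  `inner_covDivL2_covDerivL2` (`⟨f, D*Df⟩ = ‖Df‖²`).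
* §4 `PlaqL2`, `covCurlL2` / `covCoCurlL2` = (3.4)/(3.9), **`adjoint_covCurlL2`** ((3.9) IS the adjoint of the curl), `covLapPrincipalL2 := D* ∘ D`,
  `covLapPrincipalL2_eq_adjoint_comp` (`= D† ∘ D`), **`inner_covLapPrincipalL2`** (`⟨A, D*DA⟩ = ‖DA‖²`, the first term of (3.10)),
  **`covLapPrincipalL2_isSymmetric`** (*«it is a hermitian operator»*, principal part).

MODEL / DECLARED READINGS.  (M1) FIBRE: any inner-product space `V` over `𝕜`; print's fibre is the space of `N × N` hermitian matrices with
`X·Y = tr XY` (normalized trace) — a REAL inner-product space; the lattice sections §3–§4 are over `ℝ` accordingly (`W`), §1–§2 over any `RCLike 𝕜`.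
(M2) WEIGHTS: print's `η^d` (bonds/sites/plaquettes of `T_η`) and `(L^jη)^d` (block lattices) are the cases `w ≡ η^d`, `w ≡ (L^jη)^d`; the
operators' `η⁻¹` is the scalar `c`.  (M3) TRANSPORTER DATA `R`/`S` with `⟪u, R(b)v⟫ = ⟪S(b)u, v⟫` = unitarity of `R(U(b))` on the fibre, displayed
not asserted.  (M4) NOT TYPED: the curvature part `Δ′` of (3.10), `Δ_a`, `G`, `Q`, `𝔓` — next bricks; the `aQ*Q`/`DRD*` weights of [B11] p. 293.
HONEST SCOPE.  Functional-analysis packaging ([folklore] inner-product instances on a synonym) of printed pairings + exact finite-dimensional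
adjoint identities; no estimate of the paper; NOT summit progress (cell pub-balaban: NE9 NOT PRINTED / NOT PROVED; spine PROVED 0/9).  Filed by
the pub-balaban NE9 BINDER-row owner lineage `b2b-balaban-t4-ne9-p1` (gen 76) as letter (L1‴); a NEW file importing `B9Eq34CovCurlVector` only;
nothing of lit-balaban's is modified.  Net new unproved facts: 0.
-/

noncomputable section

open scoped BigOperators InnerProductSpace ComplexConjugate

namespace Literature.MathematicalPhysics.QuantumFieldTheory.Balaban1983to89.B9Eq311L2Pairing

/-! ## §1 The weighted `ℓ²` pairing `⟨f, g⟩ = Σ_x w(x)·⟨f(x), g(x)⟩` as an inner-product space -/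

section WL2

variable {X : Type*}

/-- The carrier of the weighted `L²` scalar product `⟨f, g⟩ = Σ_x w(x)⟨f(x), g(x)⟩` (print: weight `η^d` on the bonds of `T_η`, (3.11);
`(L^jη)^d` on the block lattices): functions `X → V` — a type synonym (`def`, so that the bare Pi type keeps its sup norm; the scalar field `𝕜`
is a parameter of the synonym so that the instances below are well-keyed). [cite: Balaban1985BackgroundPropagators, (3.11) p.392] -/
@[nolint unusedArguments]
def WL2 (_𝕜 : Type*) (_w : X → ℝ) (V : Type*) : Type _ := X → V

namespace WL2

variable {𝕜 : Type*} {w : X → ℝ} {V : Type*}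

/-- The identification with plain functions. [folklore] -/
protected def equiv (𝕜 : Type*) (w : X → ℝ) (V : Type*) : WL2 𝕜 w V ≃ (X → V) := Equiv.refl _

/-- The additive group structure of the carrier (that of `X → V`). [folklore] -/
instance [AddCommGroup V] : AddCommGroup (WL2 𝕜 w V) := inferInstanceAs (AddCommGroup (X → V))

/-- The module structure of the carrier (that of `X → V`). [folklore] -/
instance {R : Type*} [Semiring R] [AddCommGroup V] [Module R V] : Module R (WL2 𝕜 w V) := inferInstanceAs (Module R (X → V))

/-- The carrier is inhabited. [folklore] -/
instance [Inhabited V] : Inhabited (WL2 𝕜 w V) := inferInstanceAs (Inhabited (X → V))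

/-- Evaluation through the identification. [cite: Balaban1985BackgroundPropagators, (3.11) p.392] -/
theorem equiv_apply (f : WL2 𝕜 w V) (x : X) : WL2.equiv 𝕜 w V f x = f x := rfl

/-- The identification is additive. [cite: Balaban1985BackgroundPropagators, (3.11) p.392] -/
@[simp] theorem equiv_add [AddCommGroup V] (f g : WL2 𝕜 w V) :
    WL2.equiv 𝕜 w V (f + g) = WL2.equiv 𝕜 w V f + WL2.equiv 𝕜 w V g := rfl

/-- The identification commutes with subtraction. [cite: Balaban1985BackgroundPropagators, (3.11) p.392] -/
@[simp] theorem equiv_sub [AddCommGroup V] (f g : WL2 𝕜 w V) :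
    WL2.equiv 𝕜 w V (f - g) = WL2.equiv 𝕜 w V f - WL2.equiv 𝕜 w V g := rfl

/-- The identification maps `0` to `0`. [cite: Balaban1985BackgroundPropagators, (3.11) p.392] -/
@[simp] theorem equiv_zero [AddCommGroup V] : WL2.equiv 𝕜 w V 0 = 0 := rfl

/-- The identification commutes with scalars. [cite: Balaban1985BackgroundPropagators, (3.11) p.392] -/
@[simp] theorem equiv_smul {R : Type*} [Semiring R] [AddCommGroup V] [Module R V] (c : R) (f : WL2 𝕜 w V) :
    WL2.equiv 𝕜 w V (c • f) = c • WL2.equiv 𝕜 w V f := rfl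

/-- Evaluation of a function read in the carrier. [cite: Balaban1985BackgroundPropagators, (3.11) p.392] -/
@[simp] theorem equiv_symm_apply (f : X → V) (x : X) : (WL2.equiv 𝕜 w V).symm f x = f x := rfl

/-- The identification as a linear equivalence. [folklore] -/
protected def linearEquiv (R : Type*) [Semiring R] [AddCommGroup V] [Module R V] (𝕜 : Type*) (w : X → ℝ) :
    WL2 𝕜 w V ≃ₗ[R] (X → V) :=
  { WL2.equiv 𝕜 w V with
    map_add' := fun _ _ => rfl
    map_smul' := fun _ _ => rfl }

/-- The linear identification is the identification. [cite: Balaban1985BackgroundPropagators, (3.11) p.392] -/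
@[simp] theorem linearEquiv_apply {R : Type*} [Semiring R] [AddCommGroup V] [Module R V] (f : WL2 𝕜 w V) :
    WL2.linearEquiv R 𝕜 w f = WL2.equiv 𝕜 w V f := rfl

/-- … and its inverse. [cite: Balaban1985BackgroundPropagators, (3.11) p.392] -/
@[simp] theorem linearEquiv_symm_apply {R : Type*} [Semiring R] [AddCommGroup V] [Module R V] (f : X → V) :
    (WL2.linearEquiv R 𝕜 w).symm f = (WL2.equiv 𝕜 w V).symm f := rfl

variable [RCLike 𝕜] [NormedAddCommGroup V] [InnerProductSpace 𝕜 V] [Fintype X] [Fact (∀ x, 0 < w x)]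

/-- The weighted `ℓ²` scalar product is an inner-product CORE: Hermitian, positive DEFINITE (positive weights), sesquilinear.
[cite: Balaban1985BackgroundPropagators, (3.11) p.392] -/
@[reducible] def core : InnerProductSpace.Core 𝕜 (WL2 𝕜 w V) where
  inner f g := ∑ x, (w x : 𝕜) * ⟪WL2.equiv 𝕜 w V f x, WL2.equiv 𝕜 w V g x⟫_𝕜
  conj_inner_symm f g := by
    rw [map_sum]
    exact Finset.sum_congr rfl fun x _ => by rw [map_mul, RCLike.conj_ofReal, inner_conj_symm]
  re_inner_nonneg f := by
    rw [map_sum]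
    refine Finset.sum_nonneg fun x _ => ?_
    rw [RCLike.re_ofReal_mul]
    exact mul_nonneg ((Fact.out : ∀ x, 0 < w x) x).le inner_self_nonneg
  add_left f g h := by
    simp only [equiv_add, Pi.add_apply, inner_add_left, mul_add, Finset.sum_add_distrib]
  smul_left f g r := by
    simp only [equiv_smul, Pi.smul_apply, inner_smul_left, Finset.mul_sum]
    exact Finset.sum_congr rfl fun x _ => by ring
  definite f hf := by
    have hw : ∀ x, 0 < w x := Fact.out
    have hre : ∑ x, w x * RCLike.re ⟪WL2.equiv 𝕜 w V f x, WL2.equiv 𝕜 w V f x⟫_𝕜 = 0 := by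
      have h := congrArg RCLike.re hf
      rw [map_sum, map_zero] at h
      simpa only [RCLike.re_ofReal_mul] using h
    have hterm : ∀ x ∈ (Finset.univ : Finset X), w x * RCLike.re ⟪WL2.equiv 𝕜 w V f x, WL2.equiv 𝕜 w V f x⟫_𝕜 = 0 :=
      (Finset.sum_eq_zero_iff_of_nonneg fun x _ => mul_nonneg (hw x).le inner_self_nonneg).1 hre
    funext x
    have h := hterm x (Finset.mem_univ x)
    rw [mul_eq_zero] at h
    rcases h with h | h
    · exact absurd h (hw x).ne'
    · have : ⟪WL2.equiv 𝕜 w V f x, WL2.equiv 𝕜 w V f x⟫_𝕜 = 0 := by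
        apply RCLike.ext
        · rw [h, map_zero]
        · rw [inner_self_im, map_zero]
      exact inner_self_eq_zero.1 this

/-- **The weighted `L²` space is a normed group** (norm `‖f‖ = (Σ_x w(x)‖f(x)‖²)^{1/2}`). [folklore] -/
instance instNormedAddCommGroup : NormedAddCommGroup (WL2 𝕜 w V) := @InnerProductSpace.Core.toNormedAddCommGroup 𝕜 _ _ _ _ core

/-- **… and an inner-product space over `𝕜`** — print's *«natural L² scalar products»* (p. 391) as a Mathlib structure, so that adjoints
(`LinearMap.adjoint`), orthogonal projections and self-adjointness are available for the lattice operators. [folklore] -/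
instance instInnerProductSpace : InnerProductSpace 𝕜 (WL2 𝕜 w V) := InnerProductSpace.ofCore _

/-- **The scalar product IS `Σ_x w(x)⟨f(x), g(x)⟩`.** [cite: Balaban1985BackgroundPropagators, (3.11) p.392] -/
theorem inner_def (f g : WL2 𝕜 w V) : ⟪f, g⟫_𝕜 = ∑ x, (w x : 𝕜) * ⟪WL2.equiv 𝕜 w V f x, WL2.equiv 𝕜 w V g x⟫_𝕜 := rfl

/-- The norm: `‖f‖² = Σ_x w(x)‖f(x)‖²`. [cite: Balaban1985BackgroundPropagators, (3.11) p.392] -/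
theorem norm_sq (f : WL2 𝕜 w V) : ‖f‖ ^ 2 = ∑ x, w x * ‖WL2.equiv 𝕜 w V f x‖ ^ 2 := by
  rw [@norm_sq_eq_re_inner 𝕜, inner_def, map_sum]
  exact Finset.sum_congr rfl fun x _ => by rw [RCLike.re_ofReal_mul, inner_self_eq_norm_sq]

/-- `w(x)‖f(x)‖² ≤ ‖f‖²`: pointwise control by the weighted `L²` norm. [cite: Balaban1985BackgroundPropagators, (3.11) p.392] -/
theorem weight_mul_norm_sq_apply_le (f : WL2 𝕜 w V) (x : X) : w x * ‖WL2.equiv 𝕜 w V f x‖ ^ 2 ≤ ‖f‖ ^ 2 := by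
  rw [norm_sq]
  exact Finset.single_le_sum (f := fun x => w x * ‖WL2.equiv 𝕜 w V f x‖ ^ 2)
    (fun y _ => mul_nonneg ((Fact.out : ∀ x, 0 < w x) y).le (sq_nonneg _)) (Finset.mem_univ x)

/-- Finite-dimensional fibres give a finite-dimensional weighted `L²` space. [folklore] -/
instance instFiniteDimensional [FiniteDimensional 𝕜 V] : FiniteDimensional 𝕜 (WL2 𝕜 w V) :=
  inferInstanceAs (FiniteDimensional 𝕜 (X → V))

/-- … which is complete. [folklore] -/
instance instCompleteSpace [FiniteDimensional 𝕜 V] : CompleteSpace (WL2 𝕜 w V) := FiniteDimensional.complete 𝕜 _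

end WL2

end WL2

/-! ## §2 Adjoint pairs: the hypothesis shape `⟨Tf, g⟩ = ⟨f, Sg⟩` of the cell's B9 files IS `S = LinearMap.adjoint T` here -/

section AdjointBridge

variable {X Y : Type*} [Fintype X] [Fintype Y] {𝕜 : Type*} [RCLike 𝕜] {V V' : Type*} [NormedAddCommGroup V] [InnerProductSpace 𝕜 V]
  [NormedAddCommGroup V'] [InnerProductSpace 𝕜 V'] [FiniteDimensional 𝕜 V] [FiniteDimensional 𝕜 V'] {w : X → ℝ} {w' : Y → ℝ}
  [Fact (∀ x, 0 < w x)] [Fact (∀ y, 0 < w' y)]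

/-- **An adjoint pair in the weighted sums IS a Hilbert adjoint**: if `Σ_y w′(y)⟨(Tf)(y), g(y)⟩ = Σ_x w(x)⟨f(x), (Sg)(x)⟩` for all `f, g`, then
`S = T†` (`LinearMap.adjoint`) between the weighted `L²` spaces — the form in which `B9Thm311Data` / `B9Eq319Onto` / `B9Eq323Ker` carry their
`hadj` hypotheses, and in which `B9Eq33CovDerivVector.sum_inner_covDeriv_eq_sum_inner_covDiv` states (3.8). [cite: Balaban1985BackgroundPropagators, (3.8) p.392, (3.11) p.392] -/
theorem adjoint_eq_of_sum_inner (T : WL2 𝕜 w V →ₗ[𝕜] WL2 𝕜 w' V') (S : WL2 𝕜 w' V' →ₗ[𝕜] WL2 𝕜 w V)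
    (h : ∀ (f : WL2 𝕜 w V) (g : WL2 𝕜 w' V'),
      ∑ y, (w' y : 𝕜) * ⟪WL2.equiv 𝕜 w' V' (T f) y, WL2.equiv 𝕜 w' V' g y⟫_𝕜 =
        ∑ x, (w x : 𝕜) * ⟪WL2.equiv 𝕜 w V f x, WL2.equiv 𝕜 w V (S g) x⟫_𝕜) :
    LinearMap.adjoint T = S := by
  symm
  rw [LinearMap.eq_adjoint_iff]
  intro g f
  rw [← inner_conj_symm, WL2.inner_def, WL2.inner_def, ← h f g, ← WL2.inner_def, ← WL2.inner_def, inner_conj_symm]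

end AdjointBridge

/-! ## §3 The lattice instances: (3.8) `D*` IS the Hilbert adjoint of (3.3) `D` for the uniform `η^d`-weighted pairings -/

section Lattice

open B9SectCLatticeCarrier (Bond bpos btgt)
open B4Sect5Torus (TSite)
open B9Eq33CovDerivVector (covDeriv covDiv sum_inner_covDeriv_eq_sum_inner_covDiv)

variable {d : ℕ} {Pd : Fin d → ℕ} {W : Type*} [NormedAddCommGroup W] [InnerProductSpace ℝ W]

/-- The `L²` space of fibre-valued SITE functions of `T_η` with the uniform weight `c₀` (= `η^d`). [cite: Balaban1985BackgroundPropagators, p.391, (3.11) p.392] -/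
abbrev SiteL2 (d : ℕ) (Pd : Fin d → ℕ) (c₀ : ℝ) (W : Type*) : Type _ := WL2 ℝ (fun _ : TSite d Pd => c₀) W

/-- The `L²` space of fibre-valued BOND functions of `T_η` with the uniform weight `c₀` (= `η^d`): the pairing `⟨A, J⟩ = Σ_b η^d tr A(b)J(b)` of (3.11).
[cite: Balaban1985BackgroundPropagators, (3.11) p.392] -/
abbrev BondL2 (d : ℕ) (Pd : Fin d → ℕ) (c₀ : ℝ) (W : Type*) : Type _ := WL2 ℝ (fun _ : Bond d Pd => c₀) W

variable {c₀ : ℝ} [Fact (0 < c₀)]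

/-- Positivity of the uniform weight, as the `Fact` the instances need. [folklore] -/
instance instFactConst {ι : Type*} : Fact (∀ _ : ι, 0 < c₀) := ⟨fun _ => Fact.out⟩

/-- **(3.3) `D` between the `L²` spaces** (site functions → bond functions). [cite: Balaban1985BackgroundPropagators, (3.3) pp.390–391] -/
def covDerivL2 (c₀ c : ℝ) (R : Bond d Pd → W →ₗ[ℝ] W) [Fact (0 < c₀)] : SiteL2 d Pd c₀ W →ₗ[ℝ] BondL2 d Pd c₀ W :=
  (WL2.linearEquiv ℝ ℝ (fun _ : Bond d Pd => c₀)).symm.toLinearMap ∘ₗ covDeriv c R ∘ₗ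
    (WL2.linearEquiv ℝ ℝ (fun _ : TSite d Pd => c₀)).toLinearMap

/-- **(3.8) `D*` between the `L²` spaces** (bond functions → site functions). [cite: Balaban1985BackgroundPropagators, (3.8) p.392] -/
def covDivL2 (c₀ c : ℝ) (S : Bond d Pd → W →ₗ[ℝ] W) [Fact (0 < c₀)] : BondL2 d Pd c₀ W →ₗ[ℝ] SiteL2 d Pd c₀ W :=
  (WL2.linearEquiv ℝ ℝ (fun _ : TSite d Pd => c₀)).symm.toLinearMap ∘ₗ covDiv c S ∘ₗ
    (WL2.linearEquiv ℝ ℝ (fun _ : Bond d Pd => c₀)).toLinearMap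

/-- Unfolding: `covDerivL2` is `covDeriv` read through the identifications. [cite: Balaban1985BackgroundPropagators, (3.3) pp.390–391] -/
theorem equiv_covDerivL2 (c : ℝ) (R : Bond d Pd → W →ₗ[ℝ] W) (f : SiteL2 d Pd c₀ W) :
    WL2.equiv ℝ _ W (covDerivL2 c₀ c R f) = covDeriv c R (WL2.equiv ℝ _ W f) := rfl

/-- Unfolding: `covDivL2` is `covDiv` read through the identifications. [cite: Balaban1985BackgroundPropagators, (3.8) p.392] -/
theorem equiv_covDivL2 (c : ℝ) (S : Bond d Pd → W →ₗ[ℝ] W) (A : BondL2 d Pd c₀ W) :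
    WL2.equiv ℝ _ W (covDivL2 c₀ c S A) = covDiv c S (WL2.equiv ℝ _ W A) := rfl

/-- **`D* = D†`** (p. 391–392: *«The adjoints are taken with respect to natural L² scalar products … the adjoint operator D* is acting on functions
A defined at bonds of the lattice by the formulas (3.8)»*): on the periodic lattice with the uniform `η^d`-weights, for mutually adjoint transporter
data (`⟪w, R(b)v⟫ = ⟪S(b)w, v⟫` — print's unitary `R(U(b))`, `S = R⁻¹`), the operator (3.8) IS `LinearMap.adjoint` of (3.3).
[cite: Balaban1985BackgroundPropagators, (3.8) p.392] -/
theorem adjoint_covDerivL2 [FiniteDimensional ℝ W] (c : ℝ) (R S : Bond d Pd → W →ₗ[ℝ] W) (hRS : ∀ (b : Bond d Pd) (v u : W), ⟪u, R b v⟫_ℝ = ⟪S b u, v⟫_ℝ) :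
    LinearMap.adjoint (covDerivL2 c₀ c R) = covDivL2 c₀ c S := by
  refine adjoint_eq_of_sum_inner _ _ fun f A => ?_
  simp only [RCLike.ofReal_real_eq_id, id_eq, ← Finset.mul_sum, equiv_covDerivL2, equiv_covDivL2]
  congr 1
  have h := sum_inner_covDeriv_eq_sum_inner_covDiv c R S hRS (WL2.equiv ℝ _ W A) (WL2.equiv ℝ _ W f)
  calc ∑ b, ⟪covDeriv c R (WL2.equiv ℝ _ W f) b, WL2.equiv ℝ _ W A b⟫_ℝ
      = ∑ b, ⟪WL2.equiv ℝ _ W A b, covDeriv c R (WL2.equiv ℝ _ W f) b⟫_ℝ := Finset.sum_congr rfl fun b _ => real_inner_comm _ _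
    _ = ∑ y, ⟪covDiv c S (WL2.equiv ℝ _ W A) y, WL2.equiv ℝ _ W f y⟫_ℝ := h
    _ = ∑ y, ⟪WL2.equiv ℝ _ W f y, covDiv c S (WL2.equiv ℝ _ W A) y⟫_ℝ := Finset.sum_congr rfl fun y _ => real_inner_comm _ _

/-- Consequently `D*D = D†D` is a POSITIVE operator on the site `L²` space: `0 ≤ ⟨f, D*(Df)⟩ = ‖Df‖²`. [cite: Balaban1985BackgroundPropagators, (3.10) p.392] -/
theorem inner_covDivL2_covDerivL2 [FiniteDimensional ℝ W] (c : ℝ) (R S : Bond d Pd → W →ₗ[ℝ] W)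
    (hRS : ∀ (b : Bond d Pd) (v u : W), ⟪u, R b v⟫_ℝ = ⟪S b u, v⟫_ℝ) (f : SiteL2 d Pd c₀ W) :
    ⟪f, covDivL2 c₀ c S (covDerivL2 c₀ c R f)⟫_ℝ = ‖covDerivL2 c₀ c R f‖ ^ 2 := by
  rw [← adjoint_covDerivL2 c R S hRS, LinearMap.adjoint_inner_right, real_inner_self_eq_norm_sq]

end Lattice

/-! ## §4 The lattice instances, continued: (3.9) IS the Hilbert adjoint of the curl (3.4); `D*D` is `D†D`, symmetric and positive -/

section LatticeCurl

open B9SectCLatticeCarrier (Bond Plaq)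
open B4Sect5Torus (TSite)
open B9Eq34CovCurlVector (covCurl covCoCurl covLapPrincipal sum_inner_covCurl_eq_sum_inner_covCoCurl)

variable {d : ℕ} {Pd : Fin d → ℕ} {W : Type*} [NormedAddCommGroup W] [InnerProductSpace ℝ W] {c₀ : ℝ} [Fact (0 < c₀)]

/-- The `L²` space of fibre-valued PLAQUETTE functions of `T_η` with the uniform weight `c₀` (the pairing of `Σ_p η^d |(DA)(p)|²` in (3.10)).
[cite: Balaban1985BackgroundPropagators, (3.10) p.392] -/
abbrev PlaqL2 (d : ℕ) (Pd : Fin d → ℕ) (c₀ : ℝ) (W : Type*) : Type _ := WL2 ℝ (fun _ : Plaq d Pd => c₀) W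

/-- **(3.4) the curl between the `L²` spaces** (bond functions → plaquette functions). [cite: Balaban1985BackgroundPropagators, (3.4) p.391] -/
def covCurlL2 (c₀ c : ℝ) (R : Bond d Pd → W →ₗ[ℝ] W) [Fact (0 < c₀)] : BondL2 d Pd c₀ W →ₗ[ℝ] PlaqL2 d Pd c₀ W :=
  (WL2.linearEquiv ℝ ℝ (fun _ : Plaq d Pd => c₀)).symm.toLinearMap ∘ₗ covCurl c R ∘ₗ
    (WL2.linearEquiv ℝ ℝ (fun _ : Bond d Pd => c₀)).toLinearMap

/-- **(3.9) its adjoint between the `L²` spaces** (plaquette functions → bond functions). [cite: Balaban1985BackgroundPropagators, (3.9) p.392] -/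
def covCoCurlL2 (c₀ c : ℝ) (S : Bond d Pd → W →ₗ[ℝ] W) [Fact (0 < c₀)] : PlaqL2 d Pd c₀ W →ₗ[ℝ] BondL2 d Pd c₀ W :=
  (WL2.linearEquiv ℝ ℝ (fun _ : Bond d Pd => c₀)).symm.toLinearMap ∘ₗ covCoCurl c S ∘ₗ
    (WL2.linearEquiv ℝ ℝ (fun _ : Plaq d Pd => c₀)).toLinearMap

/-- Unfolding: `covCurlL2` is `covCurl` read through the identifications. [cite: Balaban1985BackgroundPropagators, (3.4) p.391] -/
theorem equiv_covCurlL2 (c : ℝ) (R : Bond d Pd → W →ₗ[ℝ] W) (A : BondL2 d Pd c₀ W) :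
    WL2.equiv ℝ _ W (covCurlL2 c₀ c R A) = covCurl c R (WL2.equiv ℝ _ W A) := rfl

/-- Unfolding: `covCoCurlL2` is `covCoCurl` read through the identifications. [cite: Balaban1985BackgroundPropagators, (3.9) p.392] -/
theorem equiv_covCoCurlL2 (c : ℝ) (S : Bond d Pd → W →ₗ[ℝ] W) (F : PlaqL2 d Pd c₀ W) :
    WL2.equiv ℝ _ W (covCoCurlL2 c₀ c S F) = covCoCurl c S (WL2.equiv ℝ _ W F) := rfl

/-- **(3.9) `= (3.4)†`**: on the periodic lattice with uniform weights, for mutually adjoint transporter data, the printed adjoint of the curl IS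
`LinearMap.adjoint` of the curl. [cite: Balaban1985BackgroundPropagators, (3.9) p.392] -/
theorem adjoint_covCurlL2 [FiniteDimensional ℝ W] (c : ℝ) (R S : Bond d Pd → W →ₗ[ℝ] W)
    (hRS : ∀ (b : Bond d Pd) (v u : W), ⟪u, R b v⟫_ℝ = ⟪S b u, v⟫_ℝ) :
    LinearMap.adjoint (covCurlL2 c₀ c R) = covCoCurlL2 c₀ c S := by
  refine adjoint_eq_of_sum_inner _ _ fun A F => ?_
  simp only [RCLike.ofReal_real_eq_id, id_eq, ← Finset.mul_sum, equiv_covCurlL2, equiv_covCoCurlL2]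
  congr 1
  have h := sum_inner_covCurl_eq_sum_inner_covCoCurl c R S hRS (WL2.equiv ℝ _ W F) (WL2.equiv ℝ _ W A)
  calc ∑ p, ⟪covCurl c R (WL2.equiv ℝ _ W A) p, WL2.equiv ℝ _ W F p⟫_ℝ
      = ∑ p, ⟪WL2.equiv ℝ _ W F p, covCurl c R (WL2.equiv ℝ _ W A) p⟫_ℝ := Finset.sum_congr rfl fun p _ => real_inner_comm _ _
    _ = ∑ b, ⟪covCoCurl c S (WL2.equiv ℝ _ W F) b, WL2.equiv ℝ _ W A b⟫_ℝ := h
    _ = ∑ b, ⟪WL2.equiv ℝ _ W A b, covCoCurl c S (WL2.equiv ℝ _ W F) b⟫_ℝ := Finset.sum_congr rfl fun b _ => real_inner_comm _ _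

/-- **The principal part `D*D` of `Δ` (3.10) between the `L²` spaces.** [cite: Balaban1985BackgroundPropagators, (3.10) p.392] -/
def covLapPrincipalL2 (c₀ c : ℝ) (R S : Bond d Pd → W →ₗ[ℝ] W) [Fact (0 < c₀)] : BondL2 d Pd c₀ W →ₗ[ℝ] BondL2 d Pd c₀ W :=
  covCoCurlL2 c₀ c S ∘ₗ covCurlL2 c₀ c R

/-- Unfolding: it is `covLapPrincipal` read through the identifications. [cite: Balaban1985BackgroundPropagators, (3.10) p.392] -/
theorem equiv_covLapPrincipalL2 (c : ℝ) (R S : Bond d Pd → W →ₗ[ℝ] W) (A : BondL2 d Pd c₀ W) :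
    WL2.equiv ℝ _ W (covLapPrincipalL2 c₀ c R S A) = covLapPrincipal c R S (WL2.equiv ℝ _ W A) := rfl

/-- **`D*D = D†D`**: the principal part is the composite of the curl with its Hilbert adjoint. [cite: Balaban1985BackgroundPropagators, (3.10) p.392] -/
theorem covLapPrincipalL2_eq_adjoint_comp [FiniteDimensional ℝ W] (c : ℝ) (R S : Bond d Pd → W →ₗ[ℝ] W)
    (hRS : ∀ (b : Bond d Pd) (v u : W), ⟪u, R b v⟫_ℝ = ⟪S b u, v⟫_ℝ) :
    covLapPrincipalL2 c₀ c R S = LinearMap.adjoint (covCurlL2 c₀ c R) ∘ₗ covCurlL2 c₀ c R := by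
  rw [adjoint_covCurlL2 c R S hRS]; rfl

/-- **`⟨A, D*DA⟩ = ‖DA‖²`** — the first term `Σ_p η^d |(DA)(p)|²` of the quadratic form (3.10), in the `L²` norm of the plaquette space; in
particular `D*D` is POSITIVE. [cite: Balaban1985BackgroundPropagators, (3.10) p.392] -/
theorem inner_covLapPrincipalL2 [FiniteDimensional ℝ W] (c : ℝ) (R S : Bond d Pd → W →ₗ[ℝ] W)
    (hRS : ∀ (b : Bond d Pd) (v u : W), ⟪u, R b v⟫_ℝ = ⟪S b u, v⟫_ℝ) (A : BondL2 d Pd c₀ W) :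
    ⟪A, covLapPrincipalL2 c₀ c R S A⟫_ℝ = ‖covCurlL2 c₀ c R A‖ ^ 2 := by
  rw [covLapPrincipalL2_eq_adjoint_comp c R S hRS, LinearMap.comp_apply, LinearMap.adjoint_inner_right, real_inner_self_eq_norm_sq]

/-- **`D*D` is SYMMETRIC** (p. 392: *«it is a hermitian operator given by the quadratic form … (3.10)»*, principal part).
[cite: Balaban1985BackgroundPropagators, (3.10) p.392] -/
theorem covLapPrincipalL2_isSymmetric [FiniteDimensional ℝ W] (c : ℝ) (R S : Bond d Pd → W →ₗ[ℝ] W)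
    (hRS : ∀ (b : Bond d Pd) (v u : W), ⟪u, R b v⟫_ℝ = ⟪S b u, v⟫_ℝ) :
    (covLapPrincipalL2 c₀ c R S).IsSymmetric := by
  rw [covLapPrincipalL2_eq_adjoint_comp c R S hRS]
  intro A B
  rw [LinearMap.comp_apply, LinearMap.comp_apply, LinearMap.adjoint_inner_left, LinearMap.adjoint_inner_right]

end LatticeCurl

end Literature.MathematicalPhysics.QuantumFieldTheory.Balaban1983to89.B9Eq311L2Pairing

end
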